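import Summits.Parity.GeneralizedHardyLittlewood.Theorems.PrimeLevelFamEdgeMomentsBeyondDiagonalLayersClassPascadi
import Summits.Parity.GeneralizedHardyLittlewood.Theorems.PrimeLevelFamEdgeMomentsBeyondDiagonalLayersPascadiCofactor
import HarnessLib

/-!
# Route `PrimeLevelFamEdge`, crux K_A `MomentsBeyondDiagonal` (stmt-Parity-20007), line «petersson_layers» v4:
# the per-class Pascadi inequality on the hyperbolic box for EVERY layer `r` (assembly step E6, CONDITIONAL on Pascadi's Thm 7.1)

`…LayersClassPascadi` without the hypothesis `q ∤ r`, through the every-`r` bridges of `…LayersPascadiCofactor` (proofs verbatim):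
**`norm_sum_four_le_of_pascadi_hyperbolic_all`** (`σ₂V ≤ σ₁X₁X₂ ≤ c`) and **`norm_sum_four_le_of_pascadi_hyperbolic_all'`**
(`σ₁X₁X₂ ≤ σ₂V ≤ c`).  Proof only (def-free, CONDITIONAL helper: the named fact is a HYPOTHESIS); K_A NOT proved; nothing of
Pascadi's proof is formalised; nothing about Landau–Siegel zeros.
-/

noncomputable section

open Finset
open Literature.NumberTheory.LFunctions

namespace Summit.Parity.GeneralizedHardyLittlewood.Theorems.MomentsBeyondDiagonal.Layers

/-- **The print-band saving for a class form on the hyperbolic box, `σ₂V ≤ σ₁X₁X₂ ≤ c`** (CONDITIONAL on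
`pascadi2025_theorem71`; modulus `c = q·r`, `q` prime, ANY `r ≥ 1`). [cite: Pascadi2025, Thm. 7.1 (case c = qr, a = 1)] -/
theorem norm_sum_four_le_of_pascadi_hyperbolic_all (h : pascadi2025_theorem71) {ε : ℝ} (hε : 0 < ε) :
    ∃ C : ℝ, 0 ≤ C ∧ ∀ (c q r : ℕ) [NeZero c], c = q * r → q.Prime →
      ∀ (σ₁ σ₂ X₁ X₂ Y₁ Y₂ V : ℕ), 0 < σ₁ → 0 < σ₂ →
        1 ≤ σ₂ * V → σ₂ * V ≤ σ₁ * (X₁ * X₂) → σ₁ * (X₁ * X₂) ≤ c → V ≤ Y₁ * Y₂ →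
      ∀ (A B : ℕ → ℕ → ℂ), (∀ n₁ n₂ : ℕ, V < n₁ * n₂ → B n₁ n₂ = 0) →
        (∀ m₁ ∈ Icc 1 X₁, ∀ m₂ ∈ Icc 1 X₂, ∀ n₁ ∈ Icc 1 Y₁, ∀ n₂ ∈ Icc 1 Y₂, A m₁ m₂ * B n₁ n₂ ≠ 0 →
          Nat.Coprime (Nat.gcd (σ₁ * (m₁ * m₂)) (σ₂ * (n₁ * n₂))) c) →
      ∀ (D₁ D₂ : ℝ), 0 ≤ D₁ → 0 ≤ D₂ →
        (∀ u ∈ Icc 1 (X₁ * X₂), (#u.divisors : ℝ) ≤ D₁) → (∀ v ∈ Icc 1 (Y₁ * Y₂), (#v.divisors : ℝ) ≤ D₂) →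
        ‖∑ m₁ ∈ Icc 1 X₁, ∑ n₁ ∈ Icc 1 Y₁, ∑ m₂ ∈ Icc 1 X₂, ∑ n₂ ∈ Icc 1 Y₂, A m₁ m₂ * B n₁ n₂ *
            kloostermanSum c ((σ₁ * (m₁ * m₂) : ℕ) : ZMod c) ((σ₂ * (n₁ * n₂) : ℕ) : ZMod c)‖ ≤
          C * Real.sqrt D₁ * Real.sqrt D₂ *
            Real.sqrt (∑ p ∈ Icc 1 X₁ ×ˢ Icc 1 X₂, ‖A p.1 p.2‖ ^ 2) *
            Real.sqrt (∑ p ∈ Icc 1 Y₁ ×ˢ Icc 1 Y₂, ‖B p.1 p.2‖ ^ 2) *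
            (c : ℝ) ^ (1 + ε) * (Pascadi2025.bracket71 (σ₁ * (X₁ * X₂) : ℕ) (σ₂ * V : ℕ) (c : ℝ) r r) ^ (1 / 6 : ℝ) := by
  obtain ⟨C, hC⟩ := norm_bilinear_dilated_le_of_pascadi_cofactor h hε
  refine ⟨max C 0, le_max_right _ _, ?_⟩
  intro c q r _ hc hq σ₁ σ₂ X₁ X₂ Y₁ Y₂ V hσ₁ hσ₂ hN hNM hMc hV A B hB hsupp D₁ D₂ hD₁0 hD₂0 hD₁ hD₂
  subst hc
  -- regroup on the hyperbolic box
  rw [sum_four_eq_bilinear_fiber_hyperbolic X₁ X₂ Y₁ Y₂ V A B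
    (fun u v ↦ kloostermanSum (q * r) ((σ₁ * u : ℕ) : ZMod (q * r)) ((σ₂ * v : ℕ) : ZMod (q * r))) hB,
    min_eq_left hV]
  have hcop := coprime_fiber_of_support (V := V) (c := q * r) (σ₁ := σ₁) (σ₂ := σ₂) A B hsupp
  have key := hC q r hq σ₁ σ₂ (X₁ * X₂) V hσ₁ hσ₂ hN hNM hMc _ _ hcop
  obtain ⟨h1, h2⟩ := sqrt_fiber_norms_le hV A B hD₁0 hD₂0 hD₁ hD₂
  have hP0 : 0 ≤ ((q * r : ℕ) : ℝ) ^ (1 + ε) *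
      (Pascadi2025.bracket71 (σ₁ * (X₁ * X₂) : ℕ) (σ₂ * V : ℕ) ((q * r : ℕ) : ℝ) r r) ^ (1 / 6 : ℝ) := by
    refine mul_nonneg (Real.rpow_nonneg (Nat.cast_nonneg _) _) (Real.rpow_nonneg ?_ _)
    unfold Pascadi2025.bracket71
    positivity
  have hCle : C ≤ max C 0 := le_max_left _ _
  have hM0 : 0 ≤ max C 0 := le_max_right _ _
  refine key.trans ?_
  calc C * Real.sqrt (∑ u ∈ Icc 1 (X₁ * X₂),
          ‖∑ p ∈ (Icc 1 X₁ ×ˢ Icc 1 X₂).filter (fun p : ℕ × ℕ ↦ p.1 * p.2 = u), A p.1 p.2‖ ^ 2) *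
        Real.sqrt (∑ v ∈ Icc 1 V,
          ‖∑ p ∈ (Icc 1 Y₁ ×ˢ Icc 1 Y₂).filter (fun p : ℕ × ℕ ↦ p.1 * p.2 = v), B p.1 p.2‖ ^ 2) *
        ((q * r : ℕ) : ℝ) ^ (1 + ε) *
        (Pascadi2025.bracket71 (σ₁ * (X₁ * X₂) : ℕ) (σ₂ * V : ℕ) ((q * r : ℕ) : ℝ) r r) ^ (1 / 6 : ℝ)
      ≤ max C 0 * (Real.sqrt D₁ * Real.sqrt (∑ p ∈ Icc 1 X₁ ×ˢ Icc 1 X₂, ‖A p.1 p.2‖ ^ 2)) *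
          (Real.sqrt D₂ * Real.sqrt (∑ p ∈ Icc 1 Y₁ ×ˢ Icc 1 Y₂, ‖B p.1 p.2‖ ^ 2)) *
          (((q * r : ℕ) : ℝ) ^ (1 + ε) *
          (Pascadi2025.bracket71 (σ₁ * (X₁ * X₂) : ℕ) (σ₂ * V : ℕ) ((q * r : ℕ) : ℝ) r r) ^ (1 / 6 : ℝ)) := by
        rw [mul_assoc (C * _ * _)]
        refine mul_le_mul ?_ le_rfl hP0 (by positivity)
        exact mul_le_mul (mul_le_mul hCle h1 (Real.sqrt_nonneg _) hM0) h2 (Real.sqrt_nonneg _) (by positivity)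
    _ = _ := by push_cast; ring

/-- **The print-band saving for a class form on the hyperbolic box, `σ₁X₁X₂ ≤ σ₂V ≤ c`** (the transposed ordering;
CONDITIONAL on `pascadi2025_theorem71`). [cite: Pascadi2025, Thm. 7.1 (case c = qr, a = 1, footnote: m and n swapped)] -/
theorem norm_sum_four_le_of_pascadi_hyperbolic_all' (h : pascadi2025_theorem71) {ε : ℝ} (hε : 0 < ε) :
    ∃ C : ℝ, 0 ≤ C ∧ ∀ (c q r : ℕ) [NeZero c], c = q * r → q.Prime →
      ∀ (σ₁ σ₂ X₁ X₂ Y₁ Y₂ V : ℕ), 0 < σ₁ → 0 < σ₂ →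
        1 ≤ σ₁ * (X₁ * X₂) → σ₁ * (X₁ * X₂) ≤ σ₂ * V → σ₂ * V ≤ c → V ≤ Y₁ * Y₂ →
      ∀ (A B : ℕ → ℕ → ℂ), (∀ n₁ n₂ : ℕ, V < n₁ * n₂ → B n₁ n₂ = 0) →
        (∀ m₁ ∈ Icc 1 X₁, ∀ m₂ ∈ Icc 1 X₂, ∀ n₁ ∈ Icc 1 Y₁, ∀ n₂ ∈ Icc 1 Y₂, A m₁ m₂ * B n₁ n₂ ≠ 0 →
          Nat.Coprime (Nat.gcd (σ₁ * (m₁ * m₂)) (σ₂ * (n₁ * n₂))) c) →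
      ∀ (D₁ D₂ : ℝ), 0 ≤ D₁ → 0 ≤ D₂ →
        (∀ u ∈ Icc 1 (X₁ * X₂), (#u.divisors : ℝ) ≤ D₁) → (∀ v ∈ Icc 1 (Y₁ * Y₂), (#v.divisors : ℝ) ≤ D₂) →
        ‖∑ m₁ ∈ Icc 1 X₁, ∑ n₁ ∈ Icc 1 Y₁, ∑ m₂ ∈ Icc 1 X₂, ∑ n₂ ∈ Icc 1 Y₂, A m₁ m₂ * B n₁ n₂ *
            kloostermanSum c ((σ₁ * (m₁ * m₂) : ℕ) : ZMod c) ((σ₂ * (n₁ * n₂) : ℕ) : ZMod c)‖ ≤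
          C * Real.sqrt D₁ * Real.sqrt D₂ *
            Real.sqrt (∑ p ∈ Icc 1 X₁ ×ˢ Icc 1 X₂, ‖A p.1 p.2‖ ^ 2) *
            Real.sqrt (∑ p ∈ Icc 1 Y₁ ×ˢ Icc 1 Y₂, ‖B p.1 p.2‖ ^ 2) *
            (c : ℝ) ^ (1 + ε) * (Pascadi2025.bracket71 (σ₂ * V : ℕ) (σ₁ * (X₁ * X₂) : ℕ) (c : ℝ) r r) ^ (1 / 6 : ℝ) := by
  obtain ⟨C, hC⟩ := norm_bilinear_dilated_le_of_pascadi_transposed_cofactor h hε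
  refine ⟨max C 0, le_max_right _ _, ?_⟩
  intro c q r _ hc hq σ₁ σ₂ X₁ X₂ Y₁ Y₂ V hσ₁ hσ₂ hN hNM hMc hV A B hB hsupp D₁ D₂ hD₁0 hD₂0 hD₁ hD₂
  subst hc
  rw [sum_four_eq_bilinear_fiber_hyperbolic X₁ X₂ Y₁ Y₂ V A B
    (fun u v ↦ kloostermanSum (q * r) ((σ₁ * u : ℕ) : ZMod (q * r)) ((σ₂ * v : ℕ) : ZMod (q * r))) hB,
    min_eq_left hV]
  have hcop := coprime_fiber_of_support (V := V) (c := q * r) (σ₁ := σ₁) (σ₂ := σ₂) A B hsupp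
  have key := hC q r hq σ₁ σ₂ (X₁ * X₂) V hσ₁ hσ₂ hN hNM hMc _ _ hcop
  obtain ⟨h1, h2⟩ := sqrt_fiber_norms_le hV A B hD₁0 hD₂0 hD₁ hD₂
  have hP0 : 0 ≤ ((q * r : ℕ) : ℝ) ^ (1 + ε) *
      (Pascadi2025.bracket71 (σ₂ * V : ℕ) (σ₁ * (X₁ * X₂) : ℕ) ((q * r : ℕ) : ℝ) r r) ^ (1 / 6 : ℝ) := by
    refine mul_nonneg (Real.rpow_nonneg (Nat.cast_nonneg _) _) (Real.rpow_nonneg ?_ _)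
    unfold Pascadi2025.bracket71
    positivity
  have hCle : C ≤ max C 0 := le_max_left _ _
  have hM0 : 0 ≤ max C 0 := le_max_right _ _
  refine key.trans ?_
  calc C * Real.sqrt (∑ u ∈ Icc 1 (X₁ * X₂),
          ‖∑ p ∈ (Icc 1 X₁ ×ˢ Icc 1 X₂).filter (fun p : ℕ × ℕ ↦ p.1 * p.2 = u), A p.1 p.2‖ ^ 2) *
        Real.sqrt (∑ v ∈ Icc 1 V,
          ‖∑ p ∈ (Icc 1 Y₁ ×ˢ Icc 1 Y₂).filter (fun p : ℕ × ℕ ↦ p.1 * p.2 = v), B p.1 p.2‖ ^ 2) *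
        ((q * r : ℕ) : ℝ) ^ (1 + ε) *
        (Pascadi2025.bracket71 (σ₂ * V : ℕ) (σ₁ * (X₁ * X₂) : ℕ) ((q * r : ℕ) : ℝ) r r) ^ (1 / 6 : ℝ)
      ≤ max C 0 * (Real.sqrt D₁ * Real.sqrt (∑ p ∈ Icc 1 X₁ ×ˢ Icc 1 X₂, ‖A p.1 p.2‖ ^ 2)) *
          (Real.sqrt D₂ * Real.sqrt (∑ p ∈ Icc 1 Y₁ ×ˢ Icc 1 Y₂, ‖B p.1 p.2‖ ^ 2)) *
          (((q * r : ℕ) : ℝ) ^ (1 + ε) *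
          (Pascadi2025.bracket71 (σ₂ * V : ℕ) (σ₁ * (X₁ * X₂) : ℕ) ((q * r : ℕ) : ℝ) r r) ^ (1 / 6 : ℝ)) := by
        rw [mul_assoc (C * _ * _)]
        refine mul_le_mul ?_ le_rfl hP0 (by positivity)
        exact mul_le_mul (mul_le_mul hCle h1 (Real.sqrt_nonneg _) hM0) h2 (Real.sqrt_nonneg _) (by positivity)
    _ = _ := by push_cast; ring

end Summit.Parity.GeneralizedHardyLittlewood.Theorems.MomentsBeyondDiagonal.Layers

end
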